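import Mathlib
import Summits.Ventures.HodgeRepro2.T5ConductorDualBall
import Summits.Ventures.HodgeRepro2.T5GlobalLatticeAlmostAll

/-!
# THE `ψ`-DUAL OF THE STANDARD LATTICE IS ITS FORM-DUAL; `𝒪_w^n` IS `ψ`-SELF-DUAL AT EVERY GOOD PLACE

Tier-5 support N3 / §G-N4.2 (seat p3, gen 84). The lattice model of the Weil representation of a dual pair
`(U(V), U(W))` at a finite place uses a lattice `L ⊆ V_w` that is SELF-DUAL FOR THE CHARACTER: the annihilator
of `L` under `(x, y) ↦ ψ_w(⟨x, y⟩_H)` is `L` itself. File 328 proved the one-dimensional statement; seat p8's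
`dualLattice` (T5-128) is the FORM-dual `{x | ⟨x, L⟩_H ⊆ 𝒪_w}`, and this seat's `T5GlobalLatticeAlmostAll`
proved `𝒪_w^n` form-self-dual at every `w ∉ badSet H`. This file joins the two:

* **`forall_dotProduct_eq_one_iff`** — for `ψ` of conductor exponent `0` on a valued field `K` and `c : ι → K`:
  `ψ(c ⬝ᵥ y) = 1` for every integral vector `y` iff every coordinate of `c` is integral;
* **`isInteger_adicCompletionIntegers_iff`**, **`mem_stdLattice_iff_forall_val_le_one`** — dictionary
  (`IsInteger 𝒪_w z ⟺ v z ≤ 1`; `y ∈ 𝒪_w^n ⟺ ∀ i, v (y i) ≤ 1`);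
* **`mem_dualLattice_stdLattice_iff_forall_addChar`** — THE `ψ`-DUAL OF `𝒪_w^n` IS ITS FORM-DUAL: for every
  continuous non-trivial `ψ : L_w → S¹` of conductor exponent `0` and every Gram matrix `J` over `L_w`,
  `x ∈ (𝒪_w^n)^∨_J ⟺ ∀ y ∈ 𝒪_w^n, ψ(⟨x, y⟩_J) = 1`;
* **`forall_addChar_iff_mem_stdLattice_of_notMem_badSet`** — `𝒪_w^n` IS `ψ`-SELF-DUAL at every `w ∉ badSet H`
  (`det H` a unit, the star preserving integrality): `(∀ y ∈ 𝒪_w^n, ψ(⟨x, y⟩_H) = 1) ⟺ x ∈ 𝒪_w^n`;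
* **`conductorExp_record_eq_zero`** — for the record (`K` a CM field, `v` a place of `K⁺` with `disc K ∉ v` above
  `v_p`, `w ∣ v`): `ψ_w := ψ_p ∘ Tr_{K⁺_v/ℚ_p} ∘ Tr_{K_w/K⁺_v}` has conductor exponent `0` (files 325 / 328);
  **`forall_addChar_record_iff_mem_stdLattice`** — hence `𝒪_w^n` is `ψ_w`-self-dual for `H` at every such `w`
  outside `badSet H`, with the N3 lane's star at a non-split place (`T5GlobalLatticeAlmostAll`'s
  `dualLattice_stdLattice_eq_adicCompletion`).

Nothing here is a statement about (P), theta lifts or L-values. §8(d): uses an L-value-free non-vanishing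
device: NO.
-/

open IsDedekindDomain IsDedekindDomain.HeightOneSpectrum NumberField Matrix
open Summit.Ventures.HodgeRepro2.T5AdditiveConductor Summit.Ventures.HodgeRepro2.T5UnitaryGroupIsometry
  Summit.Ventures.HodgeRepro2.T5ConductorDualBall Summit.Ventures.HodgeRepro2.T5GlobalLatticeAlmostAll

namespace Summit.Ventures.HodgeRepro2.T5ConductorDualLattice

section General

variable {K : Type*} {M : Type*} [Field K] [CommMonoid M]
variable (ψ : AddChar K M) (v : Valuation K (WithZero (Multiplicative ℤ)))
variable (hb : ∃ k : ℤ, ∀ x, v x ≤ WithZero.exp k → ψ x = 1) (hne : ∃ x, ψ x ≠ 1)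
variable {ι : Type*} [Fintype ι] [DecidableEq ι]

include hb hne in
/-- **`ψ(c ⬝ᵥ y) = 1` for every integral `y` iff `c` is integral**, for `ψ` of conductor exponent `0`
(coordinatewise: `y = r • e_i` gives `ψ(c_i r) = 1` for all integral `r`, hence `v c_i ≤ 1` by file 328;
conversely `ψ` of a sum of integral products is a product of `1`s). -/
theorem forall_dotProduct_eq_one_iff (h0 : conductorExp ψ v = 0) (c : ι → K) :
    (∀ y : ι → K, (∀ i, v (y i) ≤ 1) → ψ (c ⬝ᵥ y) = 1) ↔ ∀ i, v (c i) ≤ 1 := by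
  constructor
  · intro h i
    rw [← forall_mul_le_one_iff_of_conductorExp_eq_zero ψ v hb hne h0 (c i)]
    intro r hr
    have := h (Pi.single i r) (fun j => by
      by_cases hj : j = i
      · subst hj; simpa using hr
      · simp [hj])
    rwa [dotProduct_single] at this
  · intro hc y hy
    have hterm : ∀ i, ψ (c i * y i) = 1 := fun i =>
      (forall_mul_le_one_iff_of_conductorExp_eq_zero ψ v hb hne h0 (c i)).mpr (hc i) (y i) (hy i)
    unfold dotProduct
    induction (Finset.univ : Finset ι) using Finset.induction_on with
    | empty => simp [AddChar.map_zero_eq_one]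
    | insert a s ha ih =>
      rw [Finset.sum_insert ha, AddChar.map_add_eq_mul, hterm a, ih, one_mul]

end General

section Dictionary

variable {L : Type*} [Field L] [NumberField L] (w : HeightOneSpectrum (𝓞 L))

/-- **`IsInteger 𝒪_w z ⟺ v z ≤ 1`** on Mathlib's completion (`mem_adicCompletionIntegers`). -/
theorem isInteger_adicCompletionIntegers_iff (z : w.adicCompletion L) :
    IsLocalization.IsInteger (w.adicCompletionIntegers L) z ↔ Valued.v z ≤ 1 := by
  constructor
  · rintro ⟨r, rfl⟩
    exact (mem_adicCompletionIntegers (𝓞 L) L w).mp r.2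
  · intro h
    exact ⟨⟨z, (mem_adicCompletionIntegers (𝓞 L) L w).mpr h⟩, rfl⟩

variable {ι : Type*}

/-- **`y ∈ 𝒪_w^n ⟺ ∀ i, v (y i) ≤ 1`** (seat p8's `mem_stdLattice_iff`). -/
theorem mem_stdLattice_iff_forall_val_le_one (y : ι → w.adicCompletion L) :
    y ∈ stdLattice (w.adicCompletionIntegers L) ↔ ∀ i, Valued.v (y i) ≤ 1 := by
  rw [mem_stdLattice_iff]
  exact forall_congr' fun i => isInteger_adicCompletionIntegers_iff w (y i)

end Dictionary

section Lattice

variable {L : Type*} [Field L] [NumberField L] (w : HeightOneSpectrum (𝓞 L)) [StarRing (w.adicCompletion L)]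
variable {ι : Type*} [Fintype ι] [DecidableEq ι]
variable (ψ : AddChar (w.adicCompletion L) Circle) (hψ : Continuous ψ) (hne : ∃ y, ψ y ≠ 1)
  (h0 : conductorExp ψ (Valued.v : Valuation (w.adicCompletion L) (WithZero (Multiplicative ℤ))) = 0)

include hψ hne h0 in
/-- **THE `ψ`-DUAL OF `𝒪_w^n` IS ITS FORM-DUAL**: `x ∈ (𝒪_w^n)^∨_J ⟺ ∀ y ∈ 𝒪_w^n, ψ(⟨x, y⟩_J) = 1`, for every
continuous non-trivial `ψ` of conductor exponent `0` and every `J` (seat p8's `mem_dualLattice_stdLattice_iff`: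
`x ∈ (𝒪_w^n)^∨ ⟺ star x ᵥ* J ∈ 𝒪_w^n`; `⟨x, y⟩_J = (star x ᵥ* J) ⬝ᵥ y`; `forall_dotProduct_eq_one_iff`). -/
theorem mem_dualLattice_stdLattice_iff_forall_addChar (J : Matrix ι ι (w.adicCompletion L))
    (x : ι → w.adicCompletion L) :
    x ∈ dualLattice (w.adicCompletionIntegers L) J (stdLattice (w.adicCompletionIntegers L)) ↔
      ∀ y ∈ stdLattice (w.adicCompletionIntegers L), ψ (sesqForm J x y) = 1 := by
  have hb : ∃ k : ℤ, ∀ z, Valued.v z ≤ WithZero.exp k → ψ z = 1 :=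
    exists_forall_le_exp_of_continuous ψ hψ
  rw [mem_dualLattice_stdLattice_iff, mem_stdLattice_iff_forall_val_le_one,
    ← forall_dotProduct_eq_one_iff ψ Valued.v hb hne h0 (vecMul (star x) J)]
  constructor
  · intro h y hy
    rw [mem_stdLattice_iff_forall_val_le_one] at hy
    have := h y hy
    rwa [sesqForm, dotProduct_mulVec]
  · intro h y hy
    rw [← dotProduct_mulVec]
    exact h y ((mem_stdLattice_iff_forall_val_le_one w y).mpr hy)

include hψ hne h0 in
/-- **`𝒪_w^n` IS `ψ`-SELF-DUAL AT EVERY GOOD PLACE**: for `H` over `L` with `det H` a unit, `w ∉ badSet H`, a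
star preserving integrality, and `ψ` continuous non-trivial of conductor exponent `0`:
`(∀ y ∈ 𝒪_w^n, ψ(⟨x, y⟩_H) = 1) ⟺ x ∈ 𝒪_w^n` (this seat's `dualLattice_stdLattice_eq_of_notMem_badSet`). -/
theorem forall_addChar_iff_mem_stdLattice_of_notMem_badSet
    (hstar : ∀ z : w.adicCompletion L, IsLocalization.IsInteger (w.adicCompletionIntegers L) z →
      IsLocalization.IsInteger (w.adicCompletionIntegers L) (star z))
    {H : Matrix ι ι L} (hdet : IsUnit H.det) (hw : w ∉ badSet H) (x : ι → w.adicCompletion L) :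
    (∀ y ∈ stdLattice (w.adicCompletionIntegers L),
      ψ (sesqForm (H.map (algebraMap L (w.adicCompletion L))) x y) = 1) ↔
      x ∈ stdLattice (w.adicCompletionIntegers L) := by
  rw [← mem_dualLattice_stdLattice_iff_forall_addChar w ψ hψ hne h0,
    dualLattice_stdLattice_eq_of_notMem_badSet w hstar hdet hw]

end Lattice

section Record

variable (K : Type*) [Field K] [NumberField K]
variable (vp : HeightOneSpectrum (𝓞 ℚ)) (v : HeightOneSpectrum (𝓞 (maximalRealSubfield K)))
  [hv : v.asIdeal.LiesOver vp.asIdeal] (w : HeightOneSpectrum (𝓞 K)) [hw : w.asIdeal.LiesOver v.asIdeal]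

/-- The record's character at `w`: `ψ_w = ψ ∘ Tr_{K⁺_v/ℚ_p} ∘ Tr_{K_w/K⁺_v}` for `ψ : ℚ_p → S¹`. -/
noncomputable abbrev recordChar (ψ : AddChar (vp.adicCompletion ℚ) Circle) : AddChar (w.adicCompletion K) Circle :=
  (ψ.compAddMonoidHom
      (Algebra.trace (vp.adicCompletion ℚ) (v.adicCompletion (maximalRealSubfield K))).toAddMonoidHom).compAddMonoidHom
    (Algebra.trace (v.adicCompletion (maximalRealSubfield K)) (w.adicCompletion K)).toAddMonoidHom

/-- `ψ_w` is continuous (p4's `continuous_comp_trace` twice). -/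
theorem continuous_recordChar (ψ : AddChar (vp.adicCompletion ℚ) Circle) (hψ : Continuous ψ) :
    Continuous (recordChar K vp v w ψ) :=
  Summit.Ventures.HodgeRepro2.T5AdicCompletionConductor.continuous_comp_trace v w _
    (Summit.Ventures.HodgeRepro2.T5AdicCompletionConductor.continuous_comp_trace vp v ψ hψ)

/-- `ψ_w` is non-trivial (p4's `exists_comp_trace_ne_one` twice). -/
theorem exists_recordChar_ne_one (ψ : AddChar (vp.adicCompletion ℚ) Circle) (hne : ∃ y, ψ y ≠ 1) :
    ∃ z, recordChar K vp v w ψ z ≠ 1 :=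
  Summit.Ventures.HodgeRepro2.T5AdicCompletionConductor.exists_comp_trace_ne_one v w _
    (Summit.Ventures.HodgeRepro2.T5AdicCompletionConductor.exists_comp_trace_ne_one vp v ψ hne)

include hv hw in
/-- **`n(ψ_w) = 0` OUTSIDE `disc K`**: for `disc K ∉ v` and `ψ` continuous non-trivial with `n(ψ) = 0`,
`ψ_w = ψ ∘ Tr ∘ Tr` has conductor exponent `0` (file 325 at `v`, file 328's `e(w/v) = 1` and 325's local
clause at `w`). -/
theorem conductorExp_recordChar_eq_zero (h : ((discr K : ℤ) : 𝓞 (maximalRealSubfield K)) ∉ v.asIdeal)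
    (ψ : AddChar (vp.adicCompletion ℚ) Circle) (hψ : Continuous ψ) (hne : ∃ y, ψ y ≠ 1)
    (h0 : conductorExp ψ (Valued.v : Valuation (vp.adicCompletion ℚ) (WithZero (Multiplicative ℤ))) = 0) :
    conductorExp (recordChar K vp v w ψ)
      (Valued.v : Valuation (w.adicCompletion K) (WithZero (Multiplicative ℤ))) = 0 := by
  rw [recordChar,
    Summit.Ventures.HodgeRepro2.T5ConductorUnramifiedPlace.conductorExp_comp_trace_eq_of_ramificationIdx'_eq_one
      v w (ramificationIdx'_eq_one_of_discr_notMem K v w h) _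
      (Summit.Ventures.HodgeRepro2.T5AdicCompletionConductor.continuous_comp_trace vp v ψ hψ)
      (Summit.Ventures.HodgeRepro2.T5AdicCompletionConductor.exists_comp_trace_ne_one vp v ψ hne)]
  exact Summit.Ventures.HodgeRepro2.T5ConductorUnramifiedPlace.conductorExp_comp_trace_eq_zero_of_discr_notMem_cm
    K vp v h ψ hψ hne h0

variable {ι : Type*} [Fintype ι] [DecidableEq ι]

include hv hw in
/-- **THE RECORD — `𝒪_w^n` IS `ψ_w`-SELF-DUAL FOR `H` AT EVERY GOOD PLACE**: `K` a CM field, `v` a place of `K⁺`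
with `disc K ∉ v` above `v_p`, `w ∣ v` non-split (`[K_w : K⁺_v] = 2`, `σ ≠ 1`, the N3 lane's star
`starRingOfQuadratic h2 σ hσ`), `H` over `K` with `det H` a unit and `w ∉ badSet H`, `ψ : ℚ_p → S¹` continuous
non-trivial of conductor exponent `0`: `(∀ y ∈ 𝒪_w^n, ψ_w(⟨x, y⟩_H) = 1) ⟺ x ∈ 𝒪_w^n`. -/
theorem forall_addChar_record_iff_mem_stdLattice (h : ((discr K : ℤ) : 𝓞 (maximalRealSubfield K)) ∉ v.asIdeal)
    (h2 : Module.finrank (v.adicCompletion (maximalRealSubfield K)) (w.adicCompletion K) = 2)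
    (σ : (w.adicCompletion K) ≃ₐ[v.adicCompletion (maximalRealSubfield K)] (w.adicCompletion K)) (hσ : σ ≠ 1)
    {H : Matrix ι ι K} (hdet : IsUnit H.det) (hw' : w ∉ badSet H)
    (ψ : AddChar (vp.adicCompletion ℚ) Circle) (hψ : Continuous ψ) (hne : ∃ y, ψ y ≠ 1)
    (h0 : conductorExp ψ (Valued.v : Valuation (vp.adicCompletion ℚ) (WithZero (Multiplicative ℤ))) = 0)
    (x : ι → w.adicCompletion K) :
    letI := Summit.Ventures.HodgeRepro2.T5StarOfInvolution.starRingOfQuadratic h2 σ hσ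
    (∀ y ∈ stdLattice (w.adicCompletionIntegers K),
      recordChar K vp v w ψ (sesqForm (H.map (algebraMap K (w.adicCompletion K))) x y) = 1) ↔
      x ∈ stdLattice (w.adicCompletionIntegers K) := by
  letI := Summit.Ventures.HodgeRepro2.T5StarOfInvolution.starRingOfQuadratic h2 σ hσ
  exact forall_addChar_iff_mem_stdLattice_of_notMem_badSet w (recordChar K vp v w ψ)
    (continuous_recordChar K vp v w ψ hψ) (exists_recordChar_ne_one K vp v w ψ hne)
    (conductorExp_recordChar_eq_zero K vp v w h ψ hψ hne h0)
    (isInteger_star_starRingOfQuadratic v w h2 σ hσ) hdet hw' x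

end Record

end Summit.Ventures.HodgeRepro2.T5ConductorDualLattice
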